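import Summits.CriticalPhenomena.PercolationContinuityZ3.Theorems.PercNearOneGluingNoHeavyLowerTailSuperTerminalP3LamPortPart
import Summits.CriticalPhenomena.PercolationContinuityZ3.Theorems.PercNearOneGluingNoHeavyLowerTailSuperTerminalP3LamPortTermPairs
import HarnessLib

/-!
# `P3_λ` (`λ ≥ 3/2`) reduces to the `{s,a,b}`-component of the port with NO terminal pairs (quotable corollary)

Support file for crux `stmt-CriticalPhenomena-4575` (`NoHeavyLowerTail`), seat `prim-l12-p1` gen 33 (`--supports stmt-CriticalPhenomena-4575`);
sequel of `…SuperTerminalP3LamPortPart` (port part, pairs inside `{s,a,b}`) and `…SuperTerminalP3LamPortTermPairs` (port–terminal pairs).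
No definitions, no sorries, standard axioms.

Bond percolation `μ = prodBernoulli w` on a finite vertex type `V`, pairwise distinct `s a b c`; `F = {s↔a} ∩ {s↮b}`, `T = {s,a,b}`; the row
`P3_λ` is `μ(F)·μ(c ↔ T) ≤ λ·μ(F ∩ c ↔ T)` (sharp conjectured constant `λ = 3/2`).

* `real_congr_offDiag` — loops never matter: two weights that agree on every non-diagonal pair give the three quantities of the row the same
  value (connection events are determined by the off-diagonal pairs, cf. `SahiBlobReduction.determinedBy_openConn_offDiag`);
* `p3lam_of_portComponent` — **for every `λ ≥ 3/2`: if `P3_λ` holds for the weight `u := w·1_{E_c}`, where `E_c` is the set of non-loop pairs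
  having an endpoint `x ∉ {s,a,b,c}` joined to the port `c` by a path of pairs of non-zero weight avoiding `{s,a,b}`, then `P3_λ` holds for `w`.**
  So a counterexample to the sharp row `P3_{3/2}` with the fewest active vertices has `G ∖ {s,a,b}` connected and no pair inside `{s,a,b,c}`;
  what such a reduction does NOT remove are the pieces of `G ∖ {s,a,b,c}` that touch the port (splitting AT `c`), cf. the abstract two-piece
  counterexamples of `FROM-prim-l12-p1-g32-P3SHARP-DOWNSET-ANALYSIS.md`.
-/

namespace Summit.CriticalPhenomena.PercolationContinuityZ3.Theorems.SuperTerminalP3LamPortComponent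

open MeasureTheory Set
open Literature.Probability.Percolation Literature.Probability.Percolation.PartitionGluing
open Literature.Probability.LatticeModels (prodBernoulli)
open SuperTerminalP3LamPortPieces SuperTerminalP3LamPortPart SuperTerminalP3LamPortTermPairs
open scoped Classical

variable {V : Type*} [Fintype V]

/-! ## Loops never matter -/

omit [Fintype V] in
/-- Configurations that agree on the non-diagonal pairs have comparable open graphs. [folklore] -/
theorem openGraph_le_of_inter_offDiag {ω ω' : BondConfig V} (h : ω ∩ {e : Sym2 V | ¬ e.IsDiag} = ω' ∩ {e : Sym2 V | ¬ e.IsDiag}) :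
    openGraph ω ≤ openGraph ω' := by
  intro p q hpq
  rw [openGraph_adj] at hpq ⊢
  refine ⟨?_, hpq.2⟩
  have hm : s(p, q) ∈ ω ∩ {e : Sym2 V | ¬ e.IsDiag} := ⟨hpq.1, by simpa using hpq.2⟩
  rw [h] at hm
  exact hm.1

/-- **Loops never matter**: weights that agree on the non-diagonal pairs give the three quantities of the row `P3_λ` the same values. [folklore] -/
theorem real_congr_offDiag (w w' : Sym2 V → unitInterval) (h : ∀ e : Sym2 V, ¬ e.IsDiag → w e = w' e) (s a b c : V) :
    (prodBernoulli w).real (openConn s a ∩ (openConn s b)ᶜ : Set (BondConfig V)) =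
        (prodBernoulli w').real (openConn s a ∩ (openConn s b)ᶜ : Set (BondConfig V)) ∧
      (prodBernoulli w).real ((openConn c s)ᶜ ∩ (openConn c a)ᶜ ∩ (openConn c b)ᶜ : Set (BondConfig V))ᶜ =
        (prodBernoulli w').real ((openConn c s)ᶜ ∩ (openConn c a)ᶜ ∩ (openConn c b)ᶜ : Set (BondConfig V))ᶜ ∧
      (prodBernoulli w).real (openConn s a ∩ (openConn s b)ᶜ ∩ ((openConn c s)ᶜ ∩ (openConn c a)ᶜ ∩ (openConn c b)ᶜ)ᶜ : Set (BondConfig V)) =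
        (prodBernoulli w').real (openConn s a ∩ (openConn s b)ᶜ ∩ ((openConn c s)ᶜ ∩ (openConn c a)ᶜ ∩ (openConn c b)ᶜ)ᶜ : Set (BondConfig V)) := by
  have hcompl : ∀ {A : Set (BondConfig V)}, DeterminedBy A {z : Sym2 V | ¬ z.IsDiag} → DeterminedBy Aᶜ {z : Sym2 V | ¬ z.IsDiag} := by
    intro A hA
    rw [determinedBy_iff] at hA ⊢
    intro ω ω' hω
    simp only [mem_compl_iff, hA ω ω' hω]
  -- connection events are determined by the off-diagonal pairs (as in `SahiBlobReduction.determinedBy_openConn_offDiag`)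
  have hD : ∀ x y : V, DeterminedBy (openConn x y : Set (BondConfig V)) {z : Sym2 V | ¬ z.IsDiag} := by
    intro x y
    rw [determinedBy_iff]
    intro ω ω' hω
    simp only [openConn, mem_setOf_eq]
    exact ⟨fun hr => hr.mono (openGraph_le_of_inter_offDiag hω), fun hr => hr.mono (openGraph_le_of_inter_offDiag hω.symm)⟩
  have hF : DeterminedBy (openConn s a ∩ (openConn s b)ᶜ : Set (BondConfig V)) {z : Sym2 V | ¬ z.IsDiag} :=
    (hD s a).inter (hcompl (hD s b))
  have hI : DeterminedBy ((openConn c s)ᶜ ∩ (openConn c a)ᶜ ∩ (openConn c b)ᶜ : Set (BondConfig V)) {z : Sym2 V | ¬ z.IsDiag} :=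
    ((hcompl (hD c s)).inter (hcompl (hD c a))).inter (hcompl (hD c b))
  have hw : ∀ e ∈ {z : Sym2 V | ¬ z.IsDiag}, w e = w' e := fun e he => h e he
  exact ⟨Literature.Probability.LatticeModels.prodBernoulli_real_eq_of_determinedBy w w' hw hF MeasurableSet.of_discrete,
    Literature.Probability.LatticeModels.prodBernoulli_real_eq_of_determinedBy w w' hw (hcompl hI) MeasurableSet.of_discrete,
    Literature.Probability.LatticeModels.prodBernoulli_real_eq_of_determinedBy w w' hw (hF.inter (hcompl hI)) MeasurableSet.of_discrete⟩

/-! ## The corollary -/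

section Component
variable {s a b c : V}

/-- **`P3_λ` (`λ ≥ 3/2`) for `w` follows from `P3_λ` for `w` restricted to the pairs of the `{s,a,b}`-component of the port.**
Let `E_c` be the set of non-loop pairs `xy` with `x ∉ {s,a,b,c}` joined to `c` by a path of pairs of non-zero weight avoiding `{s,a,b}`; if the row holds
for `u := w·1_{E_c}` (no pair inside `{s,a,b,c}` survives), then it holds for `w`.  Chain: `p3lam_of_portPart` (other `{s,a,b}`-pieces), `p3lam_of_sabPairs_zero`
(pairs inside `{s,a,b}`, `λ ≥ 3/2`), `p3lam_of_{cs,ca,cb}Pair_zero` (port–terminal pairs, `λ ≥ 4/3`), `real_congr_offDiag` (loops). [this work] -/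
theorem p3lam_of_portComponent {lam : ℝ} (hlam : 3 / 2 ≤ lam) (w : Sym2 V → unitInterval)
    (hd : s ≠ a ∧ s ≠ b ∧ s ≠ c ∧ a ≠ b ∧ a ≠ c ∧ b ≠ c)
    (hrow :
      (prodBernoulli fun e => if ∃ x y : V, e = s(x, y) ∧ x ≠ y ∧ ¬ (x = s ∨ x = a ∨ x = b ∨ x = c) ∧
            (SimpleGraph.fromRel fun p q : V => ¬ (p = s ∨ p = a ∨ p = b) ∧ ¬ (q = s ∨ q = a ∨ q = b) ∧ (w s(p, q) : ℝ) ≠ 0).Reachable c x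
          then w e else 0).real (openConn s a ∩ (openConn s b)ᶜ : Set (BondConfig V)) *
        (prodBernoulli fun e => if ∃ x y : V, e = s(x, y) ∧ x ≠ y ∧ ¬ (x = s ∨ x = a ∨ x = b ∨ x = c) ∧
            (SimpleGraph.fromRel fun p q : V => ¬ (p = s ∨ p = a ∨ p = b) ∧ ¬ (q = s ∨ q = a ∨ q = b) ∧ (w s(p, q) : ℝ) ≠ 0).Reachable c x
          then w e else 0).real ((openConn c s)ᶜ ∩ (openConn c a)ᶜ ∩ (openConn c b)ᶜ : Set (BondConfig V))ᶜ ≤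
      lam * (prodBernoulli fun e => if ∃ x y : V, e = s(x, y) ∧ x ≠ y ∧ ¬ (x = s ∨ x = a ∨ x = b ∨ x = c) ∧
            (SimpleGraph.fromRel fun p q : V => ¬ (p = s ∨ p = a ∨ p = b) ∧ ¬ (q = s ∨ q = a ∨ q = b) ∧ (w s(p, q) : ℝ) ≠ 0).Reachable c x
          then w e else 0).real
          (openConn s a ∩ (openConn s b)ᶜ ∩ ((openConn c s)ᶜ ∩ (openConn c a)ᶜ ∩ (openConn c b)ᶜ)ᶜ : Set (BondConfig V))) :
    (prodBernoulli w).real (openConn s a ∩ (openConn s b)ᶜ : Set (BondConfig V)) *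
        (prodBernoulli w).real ((openConn c s)ᶜ ∩ (openConn c a)ᶜ ∩ (openConn c b)ᶜ : Set (BondConfig V))ᶜ ≤
      lam * (prodBernoulli w).real (openConn s a ∩ (openConn s b)ᶜ ∩ ((openConn c s)ᶜ ∩ (openConn c a)ᶜ ∩ (openConn c b)ᶜ)ᶜ : Set (BondConfig V)) := by
  have hlam' : 4 / 3 ≤ lam := by linarith
  set R : SimpleGraph V := SimpleGraph.fromRel fun p q : V =>
      ¬ (p = s ∨ p = a ∨ p = b) ∧ ¬ (q = s ∨ q = a ∨ q = b) ∧ (w s(p, q) : ℝ) ≠ 0 with hR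
  -- the port part `P`, with the pairs inside `{s,a,b}` killed (`P₃`), then the three port–terminal pairs killed (`P₅`)
  set P : Sym2 V → unitInterval := fun e => if e ∈ ({s, a, b, c} : Finset V).sym2 ∨
      ∃ x y : V, e = s(x, y) ∧ x ≠ y ∧ ¬ (x = s ∨ x = a ∨ x = b ∨ x = c) ∧ R.Reachable c x then w e else 0 with hP
  set P₃ : Sym2 V → unitInterval := fun e => if e = s(s, a) ∨ e = s(s, b) ∨ e = s(a, b) then 0 else P e with hP₃
  set P₅ : Sym2 V → unitInterval :=
    Function.update (Function.update (Function.update P₃ s(c, s) 0) s(c, a) 0) s(c, b) 0 with hP₅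
  set u : Sym2 V → unitInterval := fun e => if ∃ x y : V, e = s(x, y) ∧ x ≠ y ∧ ¬ (x = s ∨ x = a ∨ x = b ∨ x = c) ∧ R.Reachable c x
      then w e else 0 with hu
  -- `P₅` and `u` agree off the diagonal
  have hT : ∀ x : V, x ∈ ({s, a, b, c} : Finset V) ↔ (x = s ∨ x = a ∨ x = b ∨ x = c) := fun x => by
    simp only [Finset.mem_insert, Finset.mem_singleton]
  have hagree : ∀ e : Sym2 V, ¬ e.IsDiag → P₅ e = u e := by
    intro e he
    induction e using Sym2.ind with
    | h x y =>
      have hxy : x ≠ y := by simpa using he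
      by_cases hA : ∃ x' y' : V, s(x, y) = s(x', y') ∧ x' ≠ y' ∧ ¬ (x' = s ∨ x' = a ∨ x' = b ∨ x' = c) ∧ R.Reachable c x'
      · -- a port-component pair: it is not a terminal pair, every layer keeps `w e`
        obtain ⟨x', y', he', -, hx', -⟩ := id hA
        have hnt : s(x, y) ∉ ({s, a, b, c} : Finset V).sym2 := by
          rw [he']; exact fun h => hx' ((hT x').1 (Finset.mk_mem_sym2_iff.1 h).1)
        have ne1 : s(x, y) ≠ s(c, b) := fun h => hnt (h ▸ Finset.mk_mem_sym2_iff.2 ⟨by simp, by simp⟩)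
        have ne2 : s(x, y) ≠ s(c, a) := fun h => hnt (h ▸ Finset.mk_mem_sym2_iff.2 ⟨by simp, by simp⟩)
        have ne3 : s(x, y) ≠ s(c, s) := fun h => hnt (h ▸ Finset.mk_mem_sym2_iff.2 ⟨by simp, by simp⟩)
        have ne4 : ¬ (s(x, y) = s(s, a) ∨ s(x, y) = s(s, b) ∨ s(x, y) = s(a, b)) := by
          rintro (h | h | h) <;> exact hnt (h ▸ Finset.mk_mem_sym2_iff.2 ⟨by simp, by simp⟩)
        simp only [hP₅, Function.update_apply, if_neg ne1, if_neg ne2, if_neg ne3, hP₃, if_neg ne4, hP, hu]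
        rw [if_pos (Or.inr hA), if_pos hA]
      · -- not a port-component pair: `u e = 0`; `P₅ e = 0` unless `e` is a terminal pair other than the six, impossible off the diagonal
        have hu0 : u s(x, y) = 0 := by simp only [hu, if_neg hA]
        rw [hu0]
        simp only [hP₅, Function.update_apply]
        split_ifs with h1 h2 h3
        · rfl
        · rfl
        · rfl
        simp only [hP₃]
        split_ifs with h4
        · rfl
        simp only [hP]
        rw [if_neg]
        rintro (hmem | hA')
        · -- a terminal pair off the diagonal is one of the six
          obtain ⟨hx, hy⟩ := Finset.mk_mem_sym2_iff.1 hmem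
          rw [hT] at hx hy
          rcases hx with rfl | rfl | rfl | rfl <;> rcases hy with rfl | rfl | rfl | rfl
          all_goals first
            | exact hxy rfl
            | exact h1 rfl | exact h1 Sym2.eq_swap
            | exact h2 rfl | exact h2 Sym2.eq_swap
            | exact h3 rfl | exact h3 Sym2.eq_swap
            | exact h4 (Or.inl rfl) | exact h4 (Or.inl Sym2.eq_swap)
            | exact h4 (Or.inr (Or.inl rfl)) | exact h4 (Or.inr (Or.inl Sym2.eq_swap))
            | exact h4 (Or.inr (Or.inr rfl)) | exact h4 (Or.inr (Or.inr Sym2.eq_swap))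
        · exact hA hA'
  obtain ⟨c1, c2, c3⟩ := real_congr_offDiag P₅ u hagree s a b c
  have h5 : (prodBernoulli P₅).real (openConn s a ∩ (openConn s b)ᶜ : Set (BondConfig V)) *
        (prodBernoulli P₅).real ((openConn c s)ᶜ ∩ (openConn c a)ᶜ ∩ (openConn c b)ᶜ : Set (BondConfig V))ᶜ ≤
      lam * (prodBernoulli P₅).real (openConn s a ∩ (openConn s b)ᶜ ∩ ((openConn c s)ᶜ ∩ (openConn c a)ᶜ ∩ (openConn c b)ᶜ)ᶜ : Set (BondConfig V)) := by
    rw [c1, c2, c3]; exact hrow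
  -- peel the three port–terminal pairs, the pairs inside `{s,a,b}`, and the other `{s,a,b}`-pieces
  have h4 := p3lam_of_cbPair_zero hlam' (Function.update (Function.update P₃ s(c, s) 0) s(c, a) 0) hd h5
  have h3 := p3lam_of_caPair_zero hlam' (Function.update P₃ s(c, s) 0) hd h4
  have h2 := p3lam_of_csPair_zero hlam' P₃ hd h3
  have h1 := p3lam_of_sabPairs_zero hlam P hd h2
  exact p3lam_of_portPart hlam w hd h1

end Component

end Summit.CriticalPhenomena.PercolationContinuityZ3.Theorems.SuperTerminalP3LamPortComponent
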